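import Mathlib
import HarnessLib
import Summits.NavierStokesRegularity.NavierStokesRegularity.Theorems.WakeRatchetMinimalViscousBlowupFiredClock

/-!
# Route `WakeRatchet`, crux `MinimalViscousBlowup` (stmt-NavierStokesRegularity-22743) — LINE g11-1 «threshold ray» (ns-idea-1 g11/g12), stub S5
# `stub_typeOneClock`: THE ACTION CLAUSE FROM THE **FIRED** FRONT CLOCK (FC′) — ERRATUM-FC repair of `action_of_frontClock`

ERRATUM-FC (ns-idea-1 g12, 2026-08-29): the quiet-shell front clock (FC) of `action_of_frontClock` is unsatisfiable (vacuous); the intended hypothesis is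
the FIRED front clock (FC′) `∀ m t, 0 ≤ t < T → (∃ s ∈ [0,t], c₀ν² ≤ λ^m‖X_m(s)‖²) → T − t ≤ K/λ^{2m}` at the S4 level `c₀ = 1/(32768λ^{16})`.
* `action_of_firedClock` — **S5's ACTION clause from (FC′)** (with `0 ≤ K`): `‖X_n‖ ∈ L¹[0,T)` and `Λⁿ∫₀ᵀ‖X_n‖ ≤ (T+K)(√C + 4νλ²√c₀)`: at time `s` let `m`
  be the least quiet shell; if `m ≤ n` then `Λⁿ‖X_n(s)‖ ≤ λ^{2n}ν√(c_{n−m})` (`tails_of_nonfired`) and, for `m ≥ 2`, shell `m−1` has FIRED so (FC′) gives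
  `s ≥ T − K/λ^{2(m−1)}`; if `m > n ≥ 1` then shell `n` has fired, `s ≥ T − K/λ^{2n}` and the envelope bounds `X_n` — a pointwise cover by indicator
  functions of intervals whose integral is a geometric sum (`λ^{2j}√(c_j) ≤ √c₀ 2^{−j/2}`).  The proof is that of `action_of_frontClock` with
  `life_le_of_fired` replaced by (FC′) itself.
MODEL lattice ODEs only; nothing here concerns the Navier–Stokes equations (no NS regularity statement is proved).
`--supports stmt-NavierStokesRegularity-22743 --as helper`.
[cite: Tao2016AveragedNS, §4 Lemma 4.1 (4.5), §5; BarbatoMorandinRomito2011, §3.1]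
-/

noncomputable section

-- the summit and its single sub-problem share the name (CONVENTIONS §1)
set_option linter.dupNamespace false

open Set Filter Topology MeasureTheory

namespace Summit.NavierStokesRegularity.NavierStokesRegularity.Theorems.MinimalViscousBlowup.ThresholdRay

open Literature.Analysis.FluidPDE Literature.Analysis.FluidPDE.TaoCascade

/-! ### The ACTION clause from the fired front clock -/

/-- **S5 ACTION clause from the FIRED front clock (FC′)** (ERRATUM-FC repair of `action_of_frontClock`).  Under the trajectory clauses of S5
(regular on every `[0,T']`, one-shell datum, no shells below `0`, critical envelope `λⁿ‖X_n‖² ≤ C`), a constant `K ≥ 0` and (FC′) at the S4 level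
`c₀ = 1/(32768λ^{16})` (a shell `m` fired at some `s ≤ t` forces `T − t ≤ K/λ^{2m}`), every shell norm is integrable on `[0,T)` and
`Λⁿ ∫₀ᵀ ‖X_n‖ ≤ (T+K)(√C + 4νλ²√c₀)` for all `n` (`Λ = λ^{5/2}`). [cite: Tao2016AveragedNS, §4 Lemma 4.1 (4.5), §5; BarbatoMorandinRomito2011, §3.1] -/
theorem action_of_firedClock {ε₀ ν T C K : ℝ} (hε : 0 < ε₀) (hν : 0 < ν) (hT : 0 < T) (hK : 0 ≤ K)
    {α : Fin 4 → Fin 4 → Fin 4 → ℤ × ℤ × ℤ → ℝ} (hcan : IsCancellingCoeff α) (hα1 : ∀ i₁ i₂ i₃, |α i₁ i₂ i₃ (0, 0, 1)| ≤ 1)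
    {X₀ : Fin 4 → ℝ} {X : Fin 4 → ℤ → ℝ → ℝ}
    (hcd : ∀ i n, ContDiffOn ℝ 1 (X i n) (Ico 0 T))
    (hinit : ∀ i n, X i n 0 = if n = 0 then X₀ i else 0)
    (hlow : ∀ i n t, n < 0 → X i n t = 0)
    (hmot : ∀ i n t, 0 ≤ t → t < T → derivWithin (X i n) (Ici 0) t =
      quadTerm ε₀ α X i n t - ν * (1 + ε₀) ^ ((2 : ℝ) * n) * X i n t)
    (hreg : ∀ T' : ℝ, 0 < T' → T' < T → ∃ M : ℝ, ∀ t : ℝ, 0 ≤ t → t ≤ T' →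
      ∀ (i : Fin 4) (n : ℤ), (1 + (1 + ε₀) ^ ((10 : ℝ) * n)) * |X i n t| ≤ M)
    (henv : ∀ (n : ℤ) (t : ℝ), 0 ≤ t → t < T → (1 + ε₀) ^ n * ‖shellVec X n t‖ ^ 2 ≤ C)
    (hFC : ∀ (m : ℕ) (t : ℝ), 0 ≤ t → t < T →
      (∃ s, 0 ≤ s ∧ s ≤ t ∧ 1 / (32768 * (1 + ε₀) ^ 16) * ν ^ 2 ≤ (1 + ε₀) ^ m * ‖shellVec X m s‖ ^ 2) →
      T - t ≤ K / (1 + ε₀) ^ (2 * m)) :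
    ∀ n : ℤ, IntegrableOn (fun t => ‖shellVec X n t‖) (Ico 0 T) ∧
      bigLam ε₀ ^ n * (∫ t in Ico 0 T, ‖shellVec X n t‖) ≤
        (T + K) * (Real.sqrt C + 4 * ν * (1 + ε₀) ^ 2 * Real.sqrt (1 / (32768 * (1 + ε₀) ^ 16))) := by
  intro n
  have hl0 : (0 : ℝ) < 1 + ε₀ := by linarith
  have hl1 : (1 : ℝ) ≤ 1 + ε₀ := by linarith
  have hΛ : 0 < bigLam ε₀ := bigLam_pos (by linarith)
  set c₀ : ℝ := 1 / (32768 * (1 + ε₀) ^ 16) with hc₀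
  have hc₀0 : 0 < c₀ := by rw [hc₀]; positivity
  have hC0 : 0 ≤ C := le_trans (by positivity) (henv 0 0 le_rfl hT)
  -- continuity, envelope bound and integrability of `‖X_n‖` on `[0,T)`
  have hnormc : ContinuousOn (fun t => ‖shellVec X n t‖) (Ico 0 T) := by
    have heq : (fun t => ‖shellVec X n t‖) = fun t => Real.sqrt (∑ i : Fin 4, X i n t ^ 2) := by
      funext t; rw [← norm_shellVec_sq, Real.sqrt_sq (norm_nonneg _)]
    rw [heq]
    exact (continuousOn_finsetSum _ fun i _ => ((hcd i n).continuousOn).pow 2).sqrt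
  have hbd : ∀ t ∈ Ico (0 : ℝ) T, ‖shellVec X n t‖ ≤ Real.sqrt C := by
    intro t ht
    rcases lt_or_ge n 0 with hn | hn
    · have h0 : shellVec X n t = 0 := by
        ext j
        simp [shellVec_apply, hlow j n t hn]
      rw [h0, norm_zero]; exact Real.sqrt_nonneg C
    · have he := henv n t ht.1 ht.2
      have h1 : (1 : ℝ) ≤ (1 + ε₀) ^ n := one_le_zpow₀ hl1 hn
      have h2 : ‖shellVec X n t‖ ^ 2 ≤ C := by nlinarith [sq_nonneg ‖shellVec X n t‖]
      exact (Real.le_sqrt (norm_nonneg _) hC0).2 h2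
  have hint : IntegrableOn (fun t => ‖shellVec X n t‖) (Ico 0 T) :=
    IntegrableOn.of_bound measure_Ico_lt_top (hnormc.aestronglyMeasurable measurableSet_Ico) (Real.sqrt C)
      (ae_restrict_of_forall_mem measurableSet_Ico fun t ht => by
        rw [Real.norm_eq_abs, abs_of_nonneg (norm_nonneg _)]; exact hbd t ht)
  refine ⟨hint, ?_⟩
  have hRHS0 : 0 ≤ (T + K) * (Real.sqrt C + 4 * ν * (1 + ε₀) ^ 2 * Real.sqrt c₀) := by positivity
  -- shells below the datum
  rcases lt_or_ge n 0 with hn | hn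
  · have h0 : ∀ t, ‖shellVec X n t‖ = 0 := fun t => by
      have : shellVec X n t = 0 := by
        ext j
        simp [shellVec_apply, hlow j n t hn]
      rw [this, norm_zero]
    simp only [h0, integral_zero, mul_zero]
    exact hRHS0
  obtain ⟨n', rfl⟩ := Int.eq_ofNat_of_zero_le hn
  rw [zpow_natCast]
  -- the geometric gain of the pre-arrival tails
  set r : ℝ := Real.sqrt (1 / 2) with hr
  have hr0 : 0 ≤ r := Real.sqrt_nonneg _
  have hrsq : r ^ 2 = 1 / 2 := Real.sq_sqrt (by norm_num)
  have hr34 : r ≤ 3 / 4 := by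
    rw [hr, show (3 : ℝ) / 4 = Real.sqrt ((3 / 4) ^ 2) by rw [Real.sqrt_sq (by norm_num)]]
    exact Real.sqrt_le_sqrt (by norm_num)
  have hr1 : r < 1 := by linarith
  set cc : ℕ → ℝ := fun j => c₀ / (2 * (1 + ε₀) ^ 19) ^ j with hcc
  have hcc0 : ∀ j, 0 ≤ cc j := fun j => by simp only [hcc]; positivity
  have hgeom : ∀ j : ℕ, (1 + ε₀) ^ (2 * j) * Real.sqrt (cc j) ≤ Real.sqrt c₀ * r ^ j := by
    intro j
    have hsq : ((1 + ε₀) ^ (2 * j) * Real.sqrt (cc j)) ^ 2 ≤ (Real.sqrt c₀ * r ^ j) ^ 2 := by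
      rw [mul_pow, Real.sq_sqrt (hcc0 j), mul_pow, Real.sq_sqrt hc₀0.le, ← pow_mul, ← pow_mul,
        show 2 * j * 2 = 4 * j by ring, show j * 2 = 2 * j by ring, pow_mul r 2 j, hrsq]
      simp only [hcc]
      rw [mul_div_assoc', div_le_iff₀ (by positivity), mul_pow, pow_mul (1 + ε₀) 4 j]
      -- `(λ⁴)^j c₀ ≤ c₀ (1/2)^j (2^j (λ^19)^j)`, i.e. `(λ⁴)^j ≤ (λ^19)^j`
      have h1 : ((1 + ε₀) ^ 4) ^ j ≤ ((1 + ε₀) ^ 19) ^ j :=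
        pow_le_pow_left₀ (by positivity) (pow_le_pow_right₀ hl1 (by norm_num)) j
      have h2 : (1 / 2 : ℝ) ^ j * (2 : ℝ) ^ j = 1 := by rw [← mul_pow]; norm_num
      have h3 : c₀ * (1 / 2 : ℝ) ^ j * ((2 : ℝ) ^ j * ((1 + ε₀) ^ 19) ^ j) = c₀ * ((1 + ε₀) ^ 19) ^ j := by
        rw [show c₀ * (1 / 2 : ℝ) ^ j * ((2 : ℝ) ^ j * ((1 + ε₀) ^ 19) ^ j) =
          c₀ * ((1 / 2 : ℝ) ^ j * (2 : ℝ) ^ j) * ((1 + ε₀) ^ 19) ^ j by ring, h2, mul_one]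
      rw [h3]
      nlinarith [mul_le_mul_of_nonneg_left h1 hc₀0.le]
    exact (pow_le_pow_iff_left₀ (by positivity) (by positivity) two_ne_zero).1 hsq
  -- the cover: lengths `L m`, values `a m`, and the envelope piece `L'`, `b`
  set L : ℕ → ℝ := fun m => if m ≤ 1 then T else K / (1 + ε₀) ^ (2 * (m - 1)) with hL
  have hL0 : ∀ m, 0 ≤ L m := fun m => by
    simp only [hL]; split_ifs
    · exact hT.le
    · positivity
  set a : ℕ → ℝ := fun m => (1 + ε₀) ^ (2 * n') * ν * Real.sqrt (cc (n' - m)) with ha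
  have ha0 : ∀ m, 0 ≤ a m := fun m => by simp only [ha]; positivity
  set L' : ℝ := if n' = 0 then T else K / (1 + ε₀) ^ (2 * n') with hL'
  have hL'0 : 0 ≤ L' := by simp only [hL']; split_ifs; exact hT.le; positivity
  set b : ℝ := (1 + ε₀) ^ (2 * n') * Real.sqrt C with hb
  have hb0 : 0 ≤ b := by rw [hb]; positivity
  set G : ℝ → ℝ := fun s => (∑ m ∈ Finset.range (n' + 1), (Ici (T - L m)).indicator (fun _ => a m) s) +
    (Ici (T - L')).indicator (fun _ => b) s with hG
  -- the pointwise cover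
  have hpt : ∀ s ∈ Ico (0 : ℝ) T, bigLam ε₀ ^ n' * ‖shellVec X (n' : ℤ) s‖ ≤ G s := by
    intro s hs
    classical
    have hex := exists_nonfired_shell hε hν hreg hs.1 hs.2
    obtain ⟨m, hm, hmin⟩ : ∃ m : ℕ, (∀ s', 0 ≤ s' → s' ≤ s →
        (1 + ε₀) ^ m * ‖shellVec X (m : ℤ) s'‖ ^ 2 < 1 / (32768 * (1 + ε₀) ^ 16) * ν ^ 2) ∧
        ∀ m' < m, ¬ (∀ s', 0 ≤ s' → s' ≤ s → (1 + ε₀) ^ m' * ‖shellVec X (m' : ℤ) s'‖ ^ 2 < 1 / (32768 * (1 + ε₀) ^ 16) * ν ^ 2) :=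
      ⟨Nat.find hex, Nat.find_spec hex, fun m' hm' => Nat.find_min hex hm'⟩
    have hsum0 : 0 ≤ ∑ m ∈ Finset.range (n' + 1), (Ici (T - L m)).indicator (fun _ => a m) s :=
      Finset.sum_nonneg fun m _ => Set.indicator_nonneg (fun _ _ => ha0 m) s
    have hind0 : 0 ≤ (Ici (T - L')).indicator (fun _ => b) s := Set.indicator_nonneg (fun _ _ => hb0) s
    by_cases hmn : m ≤ n'
    · -- the tail piece `m`
      have htail := tails_of_nonfired hε hν hcan hα1 hcd hinit hmot hreg hs.1 hs.2 hm (n' - m)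
      have hidx : m + (n' - m) = n' := by omega
      rw [hidx] at htail
      have hB : (1 + ε₀) ^ n' * ‖shellVec X (n' : ℤ) s‖ ^ 2 ≤ (ν * Real.sqrt (cc (n' - m))) ^ 2 := by
        rw [mul_pow, Real.sq_sqrt (hcc0 _)]
        have htail' : (1 + ε₀) ^ n' * ‖shellVec X (n' : ℤ) s‖ ^ 2 ≤ cc (n' - m) * ν ^ 2 := by
          simpa only [hcc, hc₀] using htail
        linarith
      have hval := bigLam_pow_mul_norm_le hε (by positivity) n' hB
      have hsin : s ∈ Ici (T - L m) := by
        show T - L m ≤ s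
        simp only [hL]
        split_ifs with h1
        · linarith [hs.1]
        · -- `m ≥ 2`: shell `m − 1` is not quiet on `[0,s]`, hence FIRED; (FC′)
          have hfired := exists_fired_of_not_quiet (hmin (m - 1) (by omega))
          have := hFC (m - 1) s hs.1 hs.2 hfired
          linarith
      calc bigLam ε₀ ^ n' * ‖shellVec X (n' : ℤ) s‖ ≤ a m := by rw [ha]; linarith [hval]
        _ = (Ici (T - L m)).indicator (fun _ => a m) s := (Set.indicator_of_mem hsin (fun _ => a m)).symm
        _ ≤ ∑ m' ∈ Finset.range (n' + 1), (Ici (T - L m')).indicator (fun _ => a m') s :=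
            Finset.single_le_sum (f := fun m' => (Ici (T - L m')).indicator (fun _ => a m') s)
              (fun m' _ => Set.indicator_nonneg (fun _ _ => ha0 m') s) (Finset.mem_range.2 (by omega))
        _ ≤ G s := le_add_of_nonneg_right hind0
    · -- the envelope piece: shell `n'` has fired
      have hfired := exists_fired_of_not_quiet (hmin n' (by omega))
      have he := henv n' s hs.1 hs.2
      rw [zpow_natCast, ← Real.sq_sqrt hC0] at he
      have hval := bigLam_pow_mul_norm_le hε (Real.sqrt_nonneg C) n' he
      have hsin : s ∈ Ici (T - L') := by
        show T - L' ≤ s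
        simp only [hL']
        split_ifs with h0
        · linarith [hs.1]
        · have := hFC n' s hs.1 hs.2 hfired
          linarith
      calc bigLam ε₀ ^ n' * ‖shellVec X (n' : ℤ) s‖ ≤ b := hval
        _ = (Ici (T - L')).indicator (fun _ => b) s := (Set.indicator_of_mem hsin (fun _ => b)).symm
        _ ≤ G s := le_add_of_nonneg_left hsum0
  -- integrability of the cover and its integral
  have hterm : ∀ m, IntegrableOn ((Ici (T - L m)).indicator (fun _ => a m)) (Ico (0 : ℝ) T) :=
    fun m => (integrableOn_const (hs := measure_Ico_lt_top.ne)).indicator measurableSet_Ici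
  have hterm' : IntegrableOn ((Ici (T - L')).indicator (fun _ => b)) (Ico (0 : ℝ) T) :=
    (integrableOn_const (hs := measure_Ico_lt_top.ne)).indicator measurableSet_Ici
  have hsumint : IntegrableOn (fun s => ∑ m ∈ Finset.range (n' + 1), (Ici (T - L m)).indicator (fun _ => a m) s) (Ico (0 : ℝ) T) :=
    integrable_finsetSum _ fun m _ => hterm m
  have hGint : IntegrableOn G (Ico (0 : ℝ) T) := hsumint.add hterm'
  have hvol : ∀ Lx : ℝ, 0 ≤ Lx → volume.real (Ico (0 : ℝ) T ∩ Ici (T - Lx)) ≤ Lx := by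
    intro Lx hLx
    calc volume.real (Ico (0 : ℝ) T ∩ Ici (T - Lx)) ≤ volume.real (Icc (T - Lx) T) :=
          measureReal_mono (fun u hu => ⟨hu.2, hu.1.2.le⟩) (h₂ := measure_Icc_lt_top.ne)
      _ = Lx := by rw [Real.volume_real_Icc_of_le (by linarith)]; ring
  have hIG : ∫ s in Ico (0 : ℝ) T, G s =
      (∑ m ∈ Finset.range (n' + 1), a m * volume.real (Ico (0 : ℝ) T ∩ Ici (T - L m))) +
        b * volume.real (Ico (0 : ℝ) T ∩ Ici (T - L')) := by
    simp only [hG]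
    rw [integral_add hsumint hterm', integral_finsetSum _ fun m _ => hterm m]
    congr 1
    · refine Finset.sum_congr rfl fun m _ => ?_
      rw [setIntegral_indicator measurableSet_Ici, setIntegral_const, smul_eq_mul, mul_comm]
    · rw [setIntegral_indicator measurableSet_Ici, setIntegral_const, smul_eq_mul, mul_comm]
  -- bounds of the pieces
  have hpiece : ∀ m ∈ Finset.range (n' + 1), a m * volume.real (Ico (0 : ℝ) T ∩ Ici (T - L m)) ≤
      (T + K) * ν * (1 + ε₀) ^ 2 * Real.sqrt c₀ * r ^ (n' - m) := by
    intro m hm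
    have hmn : m ≤ n' := by simpa [Finset.mem_range, Nat.lt_succ_iff] using hm
    refine (mul_le_mul_of_nonneg_left (hvol (L m) (hL0 m)) (ha0 m)).trans ?_
    have hg := hgeom (n' - m)
    have hl2 : (1 : ℝ) ≤ (1 + ε₀) ^ 2 := one_le_pow₀ hl1
    simp only [ha, hL]
    split_ifs with h1
    · -- `m ≤ 1`, length `T`
      have hsplit : (1 + ε₀) ^ (2 * n') = (1 + ε₀) ^ (2 * m) * (1 + ε₀) ^ (2 * (n' - m)) := by
        rw [← pow_add]; congr 1; omega
      have hm2 : (1 + ε₀) ^ (2 * m) ≤ (1 + ε₀) ^ 2 := pow_le_pow_right₀ hl1 (by omega)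
      rw [hsplit]
      have e1 : (1 + ε₀) ^ (2 * m) * (1 + ε₀) ^ (2 * (n' - m)) * ν * Real.sqrt (cc (n' - m)) * T =
          T * ν * (1 + ε₀) ^ (2 * m) * ((1 + ε₀) ^ (2 * (n' - m)) * Real.sqrt (cc (n' - m))) := by ring
      rw [e1]
      have e2 : T * ν * (1 + ε₀) ^ (2 * m) * ((1 + ε₀) ^ (2 * (n' - m)) * Real.sqrt (cc (n' - m))) ≤
          T * ν * (1 + ε₀) ^ 2 * (Real.sqrt c₀ * r ^ (n' - m)) := by gcongr
      refine e2.trans ?_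
      have : 0 ≤ K * ν * (1 + ε₀) ^ 2 * (Real.sqrt c₀ * r ^ (n' - m)) := by positivity
      linarith
    · -- `m ≥ 2`, length `K/λ^{2(m-1)}`
      have hsplit : (1 + ε₀) ^ (2 * n') = (1 + ε₀) ^ (2 * (m - 1)) * (1 + ε₀) ^ (2 * (n' - m)) * (1 + ε₀) ^ 2 := by
        rw [← pow_add, ← pow_add]; congr 1; omega
      have hP : (0 : ℝ) < (1 + ε₀) ^ (2 * (m - 1)) := pow_pos hl0 _
      rw [hsplit]
      have e1 : (1 + ε₀) ^ (2 * (m - 1)) * (1 + ε₀) ^ (2 * (n' - m)) * (1 + ε₀) ^ 2 * ν * Real.sqrt (cc (n' - m)) *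
          (K / (1 + ε₀) ^ (2 * (m - 1))) = K * ν * (1 + ε₀) ^ 2 * ((1 + ε₀) ^ (2 * (n' - m)) * Real.sqrt (cc (n' - m))) := by
        field_simp
      rw [e1]
      have e2 : K * ν * (1 + ε₀) ^ 2 * ((1 + ε₀) ^ (2 * (n' - m)) * Real.sqrt (cc (n' - m))) ≤
          K * ν * (1 + ε₀) ^ 2 * (Real.sqrt c₀ * r ^ (n' - m)) := by gcongr
      refine e2.trans ?_
      have : 0 ≤ T * ν * (1 + ε₀) ^ 2 * (Real.sqrt c₀ * r ^ (n' - m)) := by positivity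
      linarith
  have hgeomsum : ∑ m ∈ Finset.range (n' + 1), r ^ (n' - m) ≤ 4 := by
    have hrefl : ∑ m ∈ Finset.range (n' + 1), r ^ (n' - m) = ∑ j ∈ Finset.range (n' + 1), r ^ j := by
      rw [← Finset.sum_range_reflect (fun j => r ^ j) (n' + 1)]
      exact Finset.sum_congr rfl fun m _ => rfl
    rw [hrefl, Finset.range_eq_Ico]
    refine (geom_sum_Ico_le_of_lt_one hr0 hr1).trans ?_
    rw [pow_zero, div_le_iff₀ (by linarith)]
    linarith
  have hsum : ∑ m ∈ Finset.range (n' + 1), a m * volume.real (Ico (0 : ℝ) T ∩ Ici (T - L m)) ≤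
      (T + K) * ν * (1 + ε₀) ^ 2 * Real.sqrt c₀ * 4 := by
    refine (Finset.sum_le_sum hpiece).trans ?_
    rw [← Finset.mul_sum]
    exact mul_le_mul_of_nonneg_left hgeomsum (by positivity)
  have henvpiece : b * volume.real (Ico (0 : ℝ) T ∩ Ici (T - L')) ≤ (T + K) * Real.sqrt C := by
    refine (mul_le_mul_of_nonneg_left (hvol L' hL'0) hb0).trans ?_
    simp only [hb, hL']
    split_ifs with h0
    · subst h0
      simp only [mul_zero, pow_zero, one_mul]
      linarith [mul_nonneg hK (Real.sqrt_nonneg C)]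
    · have hP : (0 : ℝ) < (1 + ε₀) ^ (2 * n') := pow_pos hl0 _
      have e1 : (1 + ε₀) ^ (2 * n') * Real.sqrt C * (K / (1 + ε₀) ^ (2 * n')) = K * Real.sqrt C := by field_simp
      rw [e1]
      linarith [mul_nonneg hT.le (Real.sqrt_nonneg C)]
  -- assemble
  have hmono : ∫ s in Ico (0 : ℝ) T, bigLam ε₀ ^ n' * ‖shellVec X (n' : ℤ) s‖ ≤ ∫ s in Ico (0 : ℝ) T, G s :=
    setIntegral_mono_on (hint.const_mul _) hGint measurableSet_Ico hpt
  rw [integral_const_mul, hIG] at hmono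
  linarith [hmono, hsum, henvpiece]

end Summit.NavierStokesRegularity.NavierStokesRegularity.Theorems.MinimalViscousBlowup.ThresholdRay

end
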